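import Mathlib
import Summits.Ventures.HodgeRepro2.T5HermitianIsotropicLattice
import Summits.Ventures.HodgeRepro2.T5UnramifiedTraceOne

/-!
# The self-dual hermitian lattice at an inert place: `Pᴴ H P = antidiag(1, u, 1)` over `𝒪_{E_v}`

Blind cell `pub-hodge-repro2`, seat p8 (gen 13), Tier-5 kernel support.  The record's `K_v` at an
inert place `v` is the stabiliser in `U(V_v)` of a self-dual `𝒪_{E_v}`-lattice, presented through a
basis with Gram matrix `antidiag(1, u, 1)`, `u ∈ 𝒪_{F_v}^×`.  This file assembles that presentation
in the record's own vocabulary — `R₀ = 𝒪_{F_v}` a DVR with finite residue field, `E_v / F_v`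
quadratic with the Galois conjugation `σ` as the star, `𝒪_{E_v} = integralClosure R₀ E` local with
`𝔭 𝒪_{E_v} = 𝔭_{E_v}` (unramified) — from the integral normal form `T5HermitianIsotropicLattice`
(T5-137b) and the trace decomposition `T5UnramifiedTraceOne` (T5-140), at EVERY residue
characteristic:

* `exists_congruent_J3_integral_of_isotropic_of_unramified` — **for `H` hermitian with entries
  and inverse in `𝒪_{E_v}` (the Gram matrix of a self-dual lattice) and an isotropic vector,
  `∃ P ∈ GL₃(𝒪_{E_v})` and a `σ`-fixed unit `u` with `Pᴴ H P = antidiag(1, u, 1)`**;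
* `exists_congruent_J3_integral_of_isotropic_of_unramified'` — the same with the unit `u` read
  in `𝒪_{F_v}`: `u = algebraMap R₀ E u₀`, `u₀ ∈ R₀ˣ` (`T5StarOfInvolution.star_eq_self_iff_mem_range`
  and the integrality of a `σ`-fixed integral element over the integrally closed `R₀`).

What stays a reading: that `V_v` is isotropic at `v` (printed: a hermitian form in `≥ 3` variables
over a non-archimedean local field is isotropic) and that the record's `L_v` is self-dual.

README §8(d): uses an L-value-free non-vanishing device: NO.
-/

namespace Summit.Ventures.HodgeRepro2.T5InertLatticeNormalForm

open IsLocalRing IsLocalization Matrix T5UnitaryGroupIsometry T5IntegralUnits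

variable (R₀ F E : Type*) [CommRing R₀] [IsDomain R₀] [IsDiscreteValuationRing R₀] [Field F]
  [Field E] [Algebra R₀ F] [IsFractionRing R₀ F] [Algebra F E] [Algebra R₀ E]
  [IsScalarTower R₀ F E] [FiniteDimensional F E] [Algebra.IsSeparable F E]
  [IsLocalRing (integralClosure R₀ E)] [Finite (ResidueField R₀)]

include F in
/-- **The inert-place normal form**: `H` hermitian (for the Galois star) with entries and inverse
in `𝒪_E`, isotropic; then `∃ P` with entries in `𝒪_E` and unit determinant, and a star-fixed unit
`u` of `𝒪_E`, with `Pᴴ H P = antidiag(1, u, 1)`. -/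
theorem exists_congruent_J3_integral_of_isotropic_of_unramified (h2 : Module.finrank F E = 2)
    (σ : E ≃ₐ[F] E) (hσ : σ ≠ 1)
    (hunr : (maximalIdeal R₀).map (algebraMap R₀ (integralClosure R₀ E)) =
      maximalIdeal (integralClosure R₀ E)) (H : Matrix (Fin 3) (Fin 3) E) :
    letI := T5StarOfInvolution.starRingOfQuadratic h2 σ hσ
    H.IsHermitian → (∀ i j, IsInteger (integralClosure R₀ E) (H i j)) → IsUnit H.det →
      (∀ i j, IsInteger (integralClosure R₀ E) (H⁻¹ i j)) →
      ∀ v : Fin 3 → E, v ≠ 0 → sesqForm H v v = 0 →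
      ∃ P : Matrix (Fin 3) (Fin 3) E, (∀ i j, IsInteger (integralClosure R₀ E) (P i j)) ∧
        IsRUnit (integralClosure R₀ E) P.det ∧
        ∃ u : E, IsRUnit (integralClosure R₀ E) u ∧ star u = u ∧
          Pᴴ * H * P = T5HermitianThreeElements.J3 u := by
  letI := T5StarOfInvolution.starRingOfQuadratic h2 σ hσ
  intro hH hHint hHdet hHinv v hv hv0
  haveI := T5UnramifiedUniformiser.isDiscreteValuationRing_integralClosure R₀ F E
  haveI : IsFractionRing (integralClosure R₀ E) E :=
    integralClosure.isFractionRing_of_finite_extension F E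
  exact T5HermitianIsotropicLattice.exists_congruent_J3_integral_of_isotropic_of_trace
    (fun x hx => T5StarOfInvolution.isInteger_integralClosure_star σ
      (T5QuadraticAutomorphism.apply_apply h2 σ hσ) x hx)
    (T5UnramifiedTraceOne.trace_decomposition_of_unramified R₀ F E h2 σ hσ hunr)
    hH hHint hHdet hHinv hv hv0

omit [Algebra.IsSeparable F E] [IsLocalRing (integralClosure R₀ E)] [Finite (ResidueField R₀)] in
include F in
/-- A `σ`-fixed element of `𝒪_E` lies in `R₀` (`R₀` integrally closed, `F = E^σ`). -/
theorem exists_algebraMap_eq_of_fixed (h2 : Module.finrank F E = 2) (σ : E ≃ₐ[F] E) (hσ : σ ≠ 1)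
    {u : E} (hu : IsInteger (integralClosure R₀ E) u) (hσu : σ u = u) :
    ∃ u₀ : R₀, algebraMap R₀ E u₀ = u := by
  obtain ⟨a, rfl⟩ := T5QuadraticAutomorphism.mem_range_of_fixed h2 σ hσ hσu
  obtain ⟨⟨x, hx⟩, hxa⟩ := hu
  have hint : IsIntegral R₀ a := by
    refine (isIntegral_algebraMap_iff (algebraMap F E).injective).mp ?_
    change IsIntegral R₀ x at hx
    rw [← hxa]
    exact hx
  obtain ⟨u₀, hu₀⟩ := IsIntegrallyClosed.isIntegral_iff.mp hint
  exact ⟨u₀, by rw [IsScalarTower.algebraMap_apply R₀ F E, hu₀]⟩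

include F in
/-- **The inert-place normal form with `u ∈ 𝒪_F^×`**: the unit of `antidiag(1, u, 1)` is the image
of a unit `u₀` of `R₀` (a `σ`-fixed unit of `𝒪_E` lies in `R₀` and is a unit there). -/
theorem exists_congruent_J3_integral_of_isotropic_of_unramified' (h2 : Module.finrank F E = 2)
    (σ : E ≃ₐ[F] E) (hσ : σ ≠ 1)
    (hunr : (maximalIdeal R₀).map (algebraMap R₀ (integralClosure R₀ E)) =
      maximalIdeal (integralClosure R₀ E)) (H : Matrix (Fin 3) (Fin 3) E) :
    letI := T5StarOfInvolution.starRingOfQuadratic h2 σ hσ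
    H.IsHermitian → (∀ i j, IsInteger (integralClosure R₀ E) (H i j)) → IsUnit H.det →
      (∀ i j, IsInteger (integralClosure R₀ E) (H⁻¹ i j)) →
      ∀ v : Fin 3 → E, v ≠ 0 → sesqForm H v v = 0 →
      ∃ P : Matrix (Fin 3) (Fin 3) E, (∀ i j, IsInteger (integralClosure R₀ E) (P i j)) ∧
        IsRUnit (integralClosure R₀ E) P.det ∧
        ∃ u₀ : R₀ˣ, Pᴴ * H * P = T5HermitianThreeElements.J3 (algebraMap R₀ E (u₀ : R₀)) := by
  letI := T5StarOfInvolution.starRingOfQuadratic h2 σ hσ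
  intro hH hHint hHdet hHinv v hv hv0
  obtain ⟨P, hP, hPdet, u, ⟨huint, hune, huinv⟩, hsu, hPHP⟩ :=
    exists_congruent_J3_integral_of_isotropic_of_unramified R₀ F E h2 σ hσ hunr H hH hHint hHdet
      hHinv v hv hv0
  obtain ⟨u₀, rfl⟩ := exists_algebraMap_eq_of_fixed R₀ F E h2 σ hσ huint hsu
  obtain ⟨w₀, hw₀⟩ := exists_algebraMap_eq_of_fixed R₀ F E h2 σ hσ huinv (by
    rw [map_inv₀]
    exact congrArg (·⁻¹) hsu)
  have hmul : u₀ * w₀ = 1 := by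
    apply T5UnramifiedUniformiser.algebraMap_injective R₀ F E
    rw [map_mul, map_one, hw₀, mul_inv_cancel₀ hune]
  exact ⟨P, hP, hPdet, Units.mkOfMulEqOne u₀ w₀ hmul, hPHP⟩

end Summit.Ventures.HodgeRepro2.T5InertLatticeNormalForm
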